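import Summits.NavierStokesRegularity.NavierStokesRegularity.Theorems.ScenarioCensusRowF1EventSocket
import HarnessLib

/-!
# LINE 30 «event-socket» port, part 2/4: §6 (cont.) THE EVENT-VOLUME TRANSFER (the heart of the socket), THE GENERIC ENGINE (an open killing event gives an excluded apex
# row, its evanescent corollary, the two floors), the residual of the socket is `Row_F1` itself

Re-homed for the scenario census (typer seat ns-census-typer-1 g9; the cells F1Σth / F1Σvo / F1Ξth / F1Ξvo (+ generic F1[P]th/vo) and the floors RΣS / PΣS / RΞS /
PΞS are MEMBERS OF RECORD «DECIDED IN KERNEL IN FILES» of row F1 since census v1.92 (critic idea-crit-3 g8 PASS 06:47:48Z — no price; ref ns-census-ref g11 PRE-CHECK ✓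
§16.30 item 58; lead-presearch label item 58); this port makes them TREE-decided): VERBATIM PORT of the NEW sections (§6–§8) of ns-idea-3 LINE 30 «event-socket»,
`pub/ideators/ns-idea-3/lines/event-socket/line-event-socket.lean` sha16 6529f3492cb49b94 (1484 l., lean check rc 0, 0 sorry; its §1–§5 = LINE 27/28/29 VERBATIM,
taken BY NAME from `ScenarioCensusRowF1Socket*` / `…SharpTop*` / `…ThinTop*`), split for the 400-line rule into `ScenarioCensusRowF1EventSocket` (§6 vocabulary) →
`…EventSocketTransfer` (§6 transfer + engine) → `…EventSocketEvents` (§7) → `…EventSocketRows` (§8 + census KEYS).  Lean text VERBATIM in namespace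
`…Theorems.ScenarioCensus.EventSocket` (the line's `…Cruxes.ScenarioCensusRowF1.EventSocketLine` re-homed) with `open …LiouvilleSocket …SharpTop …ThinTop`; port
edits: `@[conjecture]` on the residuals `StretchSlack` / `CrossFlowSlack` (≡ `ScenarioCensus.Row_F1`, OPEN), one-line docstrings added where missing (gate lint); `cross_smul_smul` is the tree's `UnthreadedRigidity.ThreadingJets.cross_smul_smul` taken BY NAME (review p713151).
Statements untouched.

No census VALUE is moved here (row F1 stays OPEN-WITH-LINE; the members become TREE-decided by name); NS regularity is NOT proved; `Row_F1` is untouched (zero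
movement, `evSlack_iff_rowF1` / `stretchSlack_iff_rowF1` / `crossFlowSlack_iff_rowF1`); no summit statement is proved by this file. Lemmas that restate already-landed tree declarations are taken BY NAME (gate lint `dedup.landed`): `fderiv_smul_stPull_apply` = `InviscidTop.fderiv_smul_stPull_apply`, `fderiv_smul_stPull` = `InviscidTop.fderiv_smul_stPull`, `fderiv_fderiv_smul_stPull` = `InviscidTop.fderiv_fderiv_smul_stPull`, `tendsto_clm_of_tendsto_apply` = `InviscidTop.tendsto_clm_of_tendsto_apply`, `tendsto_fderiv_fderiv_apply_of_bound` = `InviscidTop.tendsto_fderiv_fderiv_apply_of_bound`, `tendsto_fderiv_fderiv_of_bound` = `InviscidTop.tendsto_fderiv_fderiv_of_bound`, `tendsto_fderiv_fderiv_of_typeI_seq_Ioo` = `InviscidTop.tendsto_fderiv_fderiv_of_typeI_seq_Ioo`, `fderiv3_smul_stPull` = `FrozenTop.fderiv3_smul_stPull`, `tendsto_fderiv3_of_typeI_seq_Ioo` = `FrozenTop.tendsto_fderiv3_of_typeI_seq_Ioo`, `tendsto_physicalTime` = `ColumnarTop.tendsto_physicalTime`, `eventually_fast` = `ColumnarTop.eventually_fast`,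 `sqrt_timeLag` = `StretchedTop.sqrt_timeLag`, `forall_of_forall_ne_zero` = `StretchedTop.forall_of_forall_ne_zero`, `radius_eq` = `FrozenTop.radius_eq`, `jointCond_everywhere₆` = `FrozenTop.jointCond_everywhere₄`, `continuousOn_quad` = `IntegratedStretch.continuousOn_quad`, `sqrt_nu_timeLag` = `IntegratedStretch.sqrt_nu_timeLag`, `sing_of_not_bounded` = `InviscidTop.sing_of_not_bounded`, `exists_singularZoom_package₃` = `FrozenTop.exists_singularZoom_package₃`, `lapD_eq_zero_of_eq_zero` = `FrozenTop.lapD_eq_zero_of_eq_zero`, `measurableSet_top` = `IntegratedStretch.measurableSet_top`, `cross_smul_smul` = `UnthreadedRigidity.ThreadingJets.cross_smul_smul`.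
-/

-- the summit and its single problem share the name `NavierStokesRegularity` (D-0017 nested layout)
set_option linter.dupNamespace false

noncomputable section

open MeasureTheory Set Function Filter TopologicalSpace Metric
open scoped Topology NNReal ENNReal InnerProductSpace RealInnerProductSpace Laplacian

namespace Summit.NavierStokesRegularity.NavierStokesRegularity.Theorems.ScenarioCensus.EventSocket

open Literature.Analysis Literature.Analysis.FluidPDE
open Summit.NavierStokesRegularity.NavierStokesRegularity.Theorems
open Summit.NavierStokesRegularity.NavierStokesRegularity.Theorems.ScenarioCensus.LiouvilleSocket
open Summit.NavierStokesRegularity.NavierStokesRegularity.Theorems.ScenarioCensus.SharpTop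
open Summit.NavierStokesRegularity.NavierStokesRegularity.Theorems.ScenarioCensus.ThinTop

/-! ### THE EVENT-VOLUME TRANSFER (the heart of the socket; LINE 29's slice-volume transfer, generalised from the
speed event to an ARBITRARY OPEN ORDER-1 EVENT) -/

/-- **THE EVENT-VOLUME TRANSFER.**  In the singular-zoom frame (`FrozenTop.exists_singularZoom_package₃`: scales `c_j ↓ 0`, `α R = β`,
`α√ν = √β`, pointwise convergence of the rescaled fields AND of their gradients to `W ∈ 𝒦` and `∇W`): if for EVERY
fatness `δ > 0` the `δ`-fat times of the event slice of an OPEN event `P` are NULL IN EVERY SCALE WINDOW at `T`, then the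
ancient jet of the limit NEVER realises `P`.  Mechanism: a realising limit point has a realising box `I × B`
(`exists_box_event`, joint continuity of `(√(−s)W, (−s)∇W)`); each of its points is eventually physically realising
(`eventually_event`: the physical jet along the zoom converges to the ancient jet, `tendsto_physJet_zoom`), so by FATOU FOR
SETS `vol(B) ≤ liminf_j (c_jR)⁻³ vol(E_{t_j(s)})`, while the EXACT SCALING `(ν(T − t_j(s)))^{3/2} = (c_jR)³ (−s)^{3/2}`
(`IntegratedStretch.sqrt_nu_timeLag`) makes every `s ∈ I` eventually `δ`-fat (explicit `δ`); Fatou for sets in time then gives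
`vol(I) ≤ liminf_j vol(fat ∩ window_j)/λ_j = 0` (`λ_j = c_j²β`): contradiction with `vol(I) = 2η > 0`. -/
theorem no_event_of_scaleNull {T ν C : ℝ} {u : ℝ → E3 → E3} {x₀ : E3} {α β R : ℝ}
    {c : ℕ → ℝ} {W : ℝ → E3 → E3} (hν : 0 < ν) (hT : 0 < T) (hW : IsTypeIAncientMild C W)
    (hα : 0 < α) (hβ : 0 < β) (hR : 0 < R) (hαR : α * R = β) (hαν : α * Real.sqrt ν = Real.sqrt β)
    (hcpos : ∀ j, 0 < c j) (hclim : Tendsto c atTop (𝓝 0))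
    (hpt : ∀ t < 0, ∀ y : E3,
      Tendsto (fun j => (c j * α) • u (T + c j ^ 2 * β * t) (x₀ + (c j * R) • y)) atTop (𝓝 (W t y)))
    (hgrad : ∀ t < 0, ∀ y : E3,
      Tendsto (fun j => (c j * α * (c j * R)) • fderiv ℝ (u (T + c j ^ 2 * β * t)) (x₀ + (c j * R) • y)) atTop
        (𝓝 (fderiv ℝ (W t) y)))
    {P : Set Jet} (hP : IsOpen P) (hnull : ∀ δ : ℝ, 0 < δ → IsScaleNull T (evFatTimes P T ν δ u)) :
    ∀ s < (0 : ℝ), ∀ y : E3, ancientJet W s y ∉ P := by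
  intro s₀ hs₀ y₀
  by_contra hnot
  obtain ⟨η, hη, hsη, hbox⟩ := exists_box_event hW hP hs₀ hnot
  -- ### (1) space: every rescaled time of the box is eventually `δ`-fat, `δ = vol(B_η) / (2 (−s₀ + η)^{3/2})`
  have hmpos : 0 < volume (ball y₀ η) := measure_ball_pos volume y₀ hη
  have hmtop : volume (ball y₀ η) < ⊤ := measure_ball_lt_top
  have hmreal : 0 < (volume (ball y₀ η)).toReal := ENNReal.toReal_pos hmpos.ne' hmtop.ne
  have hσ₁ : 0 < -(s₀ - η) := by linarith
  have hsq₁ : 0 < Real.sqrt (-(s₀ - η)) ^ 3 := pow_pos (Real.sqrt_pos.2 hσ₁) 3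
  set δ : ℝ := (volume (ball y₀ η)).toReal / (2 * Real.sqrt (-(s₀ - η)) ^ 3) with hδdef
  have hδ : 0 < δ := div_pos hmreal (by positivity)
  have hfat : ∀ s ∈ Ioo (s₀ - η) (s₀ + η), ∀ᶠ j in atTop, T + c j ^ 2 * β * s ∈ evFatTimes P T ν δ u := by
    intro s hs
    have hs0 : s < 0 := by linarith [hs.2]
    have hs' : 0 < -s := neg_pos.2 hs0
    -- every point of the ball is eventually in the rescaled event slice
    have hev : ∀ y ∈ ball y₀ η, ∀ᶠ j in atTop,
        y ∈ (fun y : E3 => x₀ + (c j * R) • y) ⁻¹' eventSlice P T ν u (T + c j ^ 2 * β * s) := by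
      intro y hy
      exact (eventually_event hν hα hβ hαR hαν hcpos hpt hgrad hP hs0 (hbox s hs y hy)).mono fun j hj => hj
    have hFatou := measure_le_liminf_of_eventually_mem volume hev
    -- the explicit threshold is below `vol(B_η)`
    have hthr : ENNReal.ofReal (δ * Real.sqrt (-s) ^ 3) < volume (ball y₀ η) := by
      rw [ENNReal.ofReal_lt_iff_lt_toReal (by positivity) hmtop.ne]
      have hle : Real.sqrt (-s) ^ 3 ≤ Real.sqrt (-(s₀ - η)) ^ 3 :=
        pow_le_pow_left₀ (Real.sqrt_nonneg _) (Real.sqrt_le_sqrt (by linarith [hs.1])) 3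
      calc δ * Real.sqrt (-s) ^ 3 ≤ δ * Real.sqrt (-(s₀ - η)) ^ 3 := mul_le_mul_of_nonneg_left hle hδ.le
        _ = (volume (ball y₀ η)).toReal / 2 := by
            rw [hδdef]; field_simp
        _ < (volume (ball y₀ η)).toReal := by linarith
    have hev2 : ∀ᶠ j in atTop, ENNReal.ofReal (δ * Real.sqrt (-s) ^ 3) <
        volume ((fun y : E3 => x₀ + (c j * R) • y) ⁻¹' eventSlice P T ν u (T + c j ^ 2 * β * s)) :=
      eventually_lt_of_lt_liminf (lt_of_lt_of_le hthr hFatou)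
    have hev3 : ∀ᶠ j in atTop, T + c j ^ 2 * β * s ∈ Ico 0 T :=
      (ColumnarTop.tendsto_physicalTime hβ hs0 hcpos hclim).eventually (Ico_mem_nhdsLT hT)
    filter_upwards [hev2, hev3] with j h2 h3
    refine ⟨h3, ?_⟩
    have hcR : 0 < c j * R := mul_pos (hcpos j) hR
    have hcR3 : 0 < (c j * R) ^ 3 := pow_pos hcR 3
    rw [volume_preimage_zoomSpace hcR x₀] at h2
    -- multiply through by `(c_j R)³`
    have hpv : parabVol T ν (T + c j ^ 2 * β * s) = ENNReal.ofReal ((c j * R) ^ 3 * Real.sqrt (-s) ^ 3) := by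
      unfold parabVol
      rw [IntegratedStretch.sqrt_nu_timeLag hν hα hβ hαR hαν hcpos j, mul_pow]
    have hne0 : ENNReal.ofReal ((c j * R) ^ 3) ≠ 0 := (ENNReal.ofReal_pos.2 hcR3).ne'
    have key := ENNReal.mul_lt_mul_right hne0 ENNReal.ofReal_ne_top h2
    rw [← ENNReal.ofReal_mul hcR3.le, ← mul_assoc (ENNReal.ofReal ((c j * R) ^ 3)), ← ENNReal.ofReal_mul hcR3.le,
      mul_inv_cancel₀ hcR3.ne', ENNReal.ofReal_one, one_mul] at key
    calc ENNReal.ofReal δ * parabVol T ν (T + c j ^ 2 * β * s)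
        = ENNReal.ofReal ((c j * R) ^ 3 * (δ * Real.sqrt (-s) ^ 3)) := by
          rw [hpv, ← ENNReal.ofReal_mul hδ.le]; congr 1; ring
      _ < volume (eventSlice P T ν u (T + c j ^ 2 * β * s)) := key
  -- ### (2) time: Fatou for sets on the window `I` against the scale-null hypothesis along `λ_j = c_j² β`
  have hI := measure_le_liminf_of_eventually_mem volume
    (S := Ioo (s₀ - η) (s₀ + η))
    (A := fun j => Ioo (s₀ - η) (s₀ + η) ∩ (fun s : ℝ => T + c j ^ 2 * β * s) ⁻¹' evFatTimes P T ν δ u)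
    (fun s hs => (hfat s hs).mono fun j hj => ⟨hs, hj⟩)
  have ha : 0 < -(s₀ + η) := by linarith
  have hab : -(s₀ + η) < -(s₀ - η) := by linarith
  have hl : ∀ j, 0 < c j ^ 2 * β := fun j => mul_pos (pow_pos (hcpos j) 2) hβ
  have hsub : ∀ j, Ioo (s₀ - η) (s₀ + η) ∩ (fun s : ℝ => T + c j ^ 2 * β * s) ⁻¹' evFatTimes P T ν δ u ⊆
      (fun s : ℝ => T + c j ^ 2 * β * s) ⁻¹'
        (evFatTimes P T ν δ u ∩ Icc (T - c j ^ 2 * β * -(s₀ - η)) (T - c j ^ 2 * β * -(s₀ + η))) := by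
    intro j s hs
    refine ⟨hs.2, ?_, ?_⟩
    · show T - c j ^ 2 * β * -(s₀ - η) ≤ T + c j ^ 2 * β * s
      nlinarith [hl j, hs.1.1]
    · show T + c j ^ 2 * β * s ≤ T - c j ^ 2 * β * -(s₀ + η)
      nlinarith [hl j, hs.1.2]
  have hvolS : ∀ j, volume (Ioo (s₀ - η) (s₀ + η) ∩ (fun s : ℝ => T + c j ^ 2 * β * s) ⁻¹' evFatTimes P T ν δ u) ≤
      volume (evFatTimes P T ν δ u ∩ Icc (T - c j ^ 2 * β * -(s₀ - η)) (T - c j ^ 2 * β * -(s₀ + η))) /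
        ENNReal.ofReal (c j ^ 2 * β) := by
    intro j
    calc volume (Ioo (s₀ - η) (s₀ + η) ∩ (fun s : ℝ => T + c j ^ 2 * β * s) ⁻¹' evFatTimes P T ν δ u)
        ≤ volume ((fun s : ℝ => T + c j ^ 2 * β * s) ⁻¹'
            (evFatTimes P T ν δ u ∩ Icc (T - c j ^ 2 * β * -(s₀ - η)) (T - c j ^ 2 * β * -(s₀ + η)))) :=
          measure_mono (hsub j)
      _ = ENNReal.ofReal (c j ^ 2 * β)⁻¹ *
            volume (evFatTimes P T ν δ u ∩ Icc (T - c j ^ 2 * β * -(s₀ - η)) (T - c j ^ 2 * β * -(s₀ + η))) :=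
          volume_preimage_zoomTime (hl j) T _
      _ = volume (evFatTimes P T ν δ u ∩ Icc (T - c j ^ 2 * β * -(s₀ - η)) (T - c j ^ 2 * β * -(s₀ + η))) /
            ENNReal.ofReal (c j ^ 2 * β) := by
          rw [ENNReal.ofReal_inv_of_pos (hl j), mul_comm, div_eq_mul_inv]
  have hl0 : Tendsto (fun j => c j ^ 2 * β) atTop (𝓝[>] (0 : ℝ)) := by
    refine tendsto_nhdsWithin_iff.2 ⟨?_, Eventually.of_forall fun j => hl j⟩
    have h := (hclim.pow 2).mul_const β
    rw [zero_pow two_ne_zero, zero_mul] at h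
    exact h
  have hlim0 := (hnull δ hδ (-(s₀ + η)) (-(s₀ - η)) ha hab).comp hl0
  have hliminf0 : liminf (fun j => volume (Ioo (s₀ - η) (s₀ + η) ∩
      (fun s : ℝ => T + c j ^ 2 * β * s) ⁻¹' evFatTimes P T ν δ u)) atTop ≤ 0 := by
    calc liminf (fun j => volume (Ioo (s₀ - η) (s₀ + η) ∩
            (fun s : ℝ => T + c j ^ 2 * β * s) ⁻¹' evFatTimes P T ν δ u)) atTop
        ≤ liminf (fun j => volume (evFatTimes P T ν δ u ∩
            Icc (T - c j ^ 2 * β * -(s₀ - η)) (T - c j ^ 2 * β * -(s₀ + η))) / ENNReal.ofReal (c j ^ 2 * β)) atTop :=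
          liminf_le_liminf (Eventually.of_forall hvolS)
      _ = 0 := hlim0.liminf_eq
  have hI0 : volume (Ioo (s₀ - η) (s₀ + η)) = 0 := le_antisymm (hI.trans hliminf0) bot_le
  have hIpos : 0 < volume (Ioo (s₀ - η) (s₀ + η)) := by
    rw [Real.volume_Ioo]
    exact ENNReal.ofReal_pos.2 (by linarith)
  exact absurd hI0 hIpos.ne'

/-! ### THE GENERIC ENGINE: an OPEN, KILLING event gives an excluded apex row, its evanescent corollary, the two floors,
and a residual equivalent to `Row_F1` -/

/-- **Socket theorem (apex).**  For an OPEN event `P` that KILLS, the row «P-THIN TOP» holds.  Engine: non-extendability at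
some `x₀` (`hasSmoothExtensionPast_of_forall_exists_parabolicCylinder`) → singular zoom with a non-trivial limit `W ∈ 𝒦_M`
(`FrozenTop.exists_singularZoom_package₃`, with gradient convergence) → the event-volume transfer (`no_event_of_scaleNull`) says the
ancient jet never realises `P` → the kill gives `W ≡ 0`: contradiction. -/
theorem evRow_of_kills {P : Set Jet} (hP : IsOpen P) (hK : EventKills P) : EvRow P := by
  intro ν T hν hT u p hsol hLH hdec hTI hnull
  obtain ⟨M, hM⟩ := exists_isTypeIBlowupWith hν hTI
  apply hasSmoothExtensionPast_of_forall_exists_parabolicCylinder hν hT hsol hLH hdec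
  intro x₀
  by_contra hno
  obtain ⟨α, β, R, c, W, hα, hβ, hR, hαR, hαν, hcpos, hclim, hW, hpt, hgrad, -, -, t, ht, y, hne⟩ :=
    FrozenTop.exists_singularZoom_package₃ hν hT hsol hLH hdec hM x₀ (InviscidTop.sing_of_not_bounded hno)
  exact hne (hK M W hW (no_event_of_scaleNull hν hT hW hα hβ hR hαR hαν hcpos hclim hpt hgrad hP hnull) t ht y)

/-- **Socket theorem (floor).**  For an open killing event, «P-FAT SLICES RECUR» on every maximal Type-I blow-up. -/
theorem evFloor_of_kills {P : Set Jet} (hP : IsOpen P) (hK : EventKills P) : EvFloor P := by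
  intro ν T hν hT u p hmax hLH hdec hTI
  by_contra hno
  push Not at hno
  exact hmax.2 (evRow_of_kills hP hK ν T hν hT u p hmax.1 hLH hdec hTI hno)

/-- Fatness read as a lower bound on the event FRACTION: `t` is `δ`-fat iff `t ∈ [0,T)` and `δ < Φ_P(t)` (`ν > 0`). -/
theorem mem_evFatTimes_iff {P : Set Jet} {T ν δ : ℝ} (hν : 0 < ν) {u : ℝ → E3 → E3} {t : ℝ} :
    t ∈ evFatTimes P T ν δ u ↔ t ∈ Ico 0 T ∧ ENNReal.ofReal δ < evFraction P T ν u t := by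
  constructor
  · rintro ⟨ht, hlt⟩
    refine ⟨ht, ?_⟩
    unfold evFraction
    rw [ENNReal.lt_div_iff_mul_lt (Or.inl (parabVol_pos hν ht.2).ne') (Or.inl (parabVol_ne_top _ _ _))]
    exact hlt
  · rintro ⟨ht, hlt⟩
    refine ⟨ht, ?_⟩
    unfold evFraction at hlt
    rw [ENNReal.lt_div_iff_mul_lt (Or.inl (parabVol_pos hν ht.2).ne') (Or.inl (parabVol_ne_top _ _ _))] at hlt
    exact hlt

/-- `Φ_P → 0` ⇒ every `δ`-fat set of event times is eventually empty, hence scale-null. -/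
theorem isScaleNull_evFatTimes_of_tendsto_zero {P : Set Jet} {T ν : ℝ} (hν : 0 < ν) (hT : 0 < T) {u : ℝ → E3 → E3}
    (h : Tendsto (evFraction P T ν u) (𝓝[<] T) (𝓝 0)) {δ : ℝ} (hδ : 0 < δ) :
    IsScaleNull T (evFatTimes P T ν δ u) := by
  have hev : ∀ᶠ t in 𝓝[<] T, evFraction P T ν u t < ENNReal.ofReal δ :=
    h (Iio_mem_nhds (ENNReal.ofReal_pos.2 hδ))
  obtain ⟨t₁, ht₁T, ht₁⟩ := (mem_nhdsLT_iff_exists_Ioo_subset).1 hev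
  refine isScaleNull_of_subset_Iic (T := T) (t₁ := max t₁ 0) (max_lt ht₁T hT) ?_
  intro t ht
  by_contra hgt
  simp only [mem_Iic, not_le, max_lt_iff] at hgt
  have htT : t < T := ht.1.2
  have hlt : evFraction P T ν u t < ENNReal.ofReal δ := ht₁ ⟨hgt.1, htT⟩
  have hfat := ((mem_evFatTimes_iff hν).1 ht).2
  exact absurd (hlt.trans hfat) (lt_irrefl _)

/-- **Order of the socket's rows**: the evanescent row follows from the apex row (any event). -/
theorem evRowVo_of_evRow {P : Set Jet} (h : EvRow P) : EvRowVo P := by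
  intro ν T hν hT u p hsol hLH hdec hTI hlim
  exact h ν T hν hT u p hsol hLH hdec hTI fun δ hδ => isScaleNull_evFatTimes_of_tendsto_zero hν hT hlim hδ

/-- The evanescent corollary row of an open killing event holds. -/
theorem evRowVo_of_kills {P : Set Jet} (hP : IsOpen P) (hK : EventKills P) : EvRowVo P :=
  evRowVo_of_evRow (evRow_of_kills hP hK)

/-- The persistence floor of an open killing event holds. -/
theorem evFloorVo_of_kills {P : Set Jet} (hP : IsOpen P) (hK : EventKills P) : EvFloorVo P := by
  intro ν T hν hT u p hmax hLH hdec hTI hlim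
  exact hmax.2 (evRowVo_of_kills hP hK ν T hν hT u p hmax.1 hLH hdec hTI hlim)

/-! ### The residual of the socket is `Row_F1` itself (for an open killing event) -/

/-- **Split**: the apex row and the slack give `Row_F1`. -/
theorem rowF1_of_evRow {P : Set Jet} (hR : EvRow P) (hS : EvSlack P) : ScenarioCensus.Row_F1 := by
  unfold ScenarioCensus.Row_F1
  intro ν T hν hT u p hsol hLH hdec hTI
  by_contra hext
  exact hext (hR ν T hν hT u p hsol hLH hdec hTI (hS ν T hν hT u p ⟨hsol, hext⟩ hLH hdec hTI))

/-- `Row_F1` gives every slack vacuously (a maximal solution with an extension is a contradiction). -/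
theorem evSlack_of_rowF1 (P : Set Jet) (h : ScenarioCensus.Row_F1) : EvSlack P :=
  fun ν T hν hT u p hmax hLH hdec hTI _ _ => absurd (h ν T hν hT u p hmax.1 hLH hdec hTI) hmax.2

/-- **The residual of an open killing event is EQUIVALENT to `Row_F1`** (honest label: summit-hard). -/
theorem evSlack_iff_rowF1 {P : Set Jet} (hP : IsOpen P) (hK : EventKills P) : EvSlack P ↔ ScenarioCensus.Row_F1 :=
  ⟨rowF1_of_evRow (evRow_of_kills hP hK), evSlack_of_rowF1 P⟩

/-- The floor is the NEGATION of the slack on blow-ups, packaged: floor and slack together exclude maximal Type-I blow-up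
data outright (so, given the floor, the slack is exactly what is missing). -/
theorem evFloor_evSlack_exclude {P : Set Jet} (hF : EvFloor P) (hS : EvSlack P) :
    ∀ (ν T : ℝ), 0 < ν → 0 < T → ∀ (u : ℝ → E3 → E3) (p : ℝ → E3 → ℝ),
      IsMaximalSmoothSolution ν 0 u p T → IsLerayHopfOn T ν 0 (u 0) u → HasRapidSpatialDecay (u 0) →
      ¬ IsTypeIBlowup u T := by
  intro ν T hν hT u p hmax hLH hdec hTI
  obtain ⟨δ, hδ, hnot⟩ := hF ν T hν hT u p hmax hLH hdec hTI
  exact hnot (hS ν T hν hT u p hmax hLH hdec hTI δ hδ)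

end Summit.NavierStokesRegularity.NavierStokesRegularity.Theorems.ScenarioCensus.EventSocket

end
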